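import Mathlib
import HarnessLib
import Summits.Ventures.LatticeQCDFlow.Exactness.Phi4JitteredHMC

/-!
# The φ⁴ engine's `tau_jitter` for an ARBITRARY law of the trajectory length — continuous laws included: joint measurability of the labelled qpq / pqp proposals, the kernels, exactness for every law

HONEST FRAMING: exact (Metropolis-corrected) sampling algorithms for lattice gauge theory;
figures of merit are autocorrelation/cost numbers at stated couplings and volumes; no
continuum-physics claim.

Venture `LatticeQCDFlow` (cell pub-lqcd), topic `Exactness`, FANOUT row 9 (eng-latcore, GEN-24; the engine's
`latflow.core.phi4_2d.hmc(f, m2, lam, rng, tau, nstep, ntraj, variant ∈ {qpq, pqp}, tau_jitter = j)`: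
`tau_t = tau * (1 + tau_jitter * (2u − 1))`, `u ∼ U(0,1)`, `eps = tau_t / nstep` — the LENGTH is drawn from a
CONTINUOUS law in exact arithmetic).  NEW WORK of the cell over GEN-22's `Phi4JitteredHMC.lean` (the COUNTABLE-label
kernels `phi4JitterHMC` / `phi4JitterHMCPQP`, `phi4KineticLaw`, `phi4KineticWeight_univ_ne_zero/_ne_top`,
`measurable_phi4Kinetic`), `JitteredHMC.lean` (`jitterHMC`, `measurable_jitterMap`, `jitterHMC_exact`, `jitterHMC_apply`,
`isMarkovKernel_jitterHMC`), `Phi4LeapfrogPerm.lean` / `Phi4HMCExact.lean` (`hmcProposal`, `hmcProposalPQP`, their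
involutivity and Liouville property), row 2's `Scoring/FreeFieldLeapfrog*.lean` (`leapfrogQPQ`, `leapfrogPQP`, `lfDrift`,
`lfKick`, `latticePhi4Force`, `latticePhi4Action`).  Nothing is cited as a fact; no number is claimed.  The `SU(N)`
counterpart is GEN-24's `SUNJitteredHMCMeasurableLabels.lean`; the code's law `uniformJitterLaw τ j` is GEN-24's
`UniformJitterLaw.lean` (not imported: exactness below holds for EVERY law).

## Content (`Λ = Fin (n+1)` sites, couplings `J`, quartic coupling `λ`; labels in ANY measurable space `Lab`,
## measurable step sizes `δ : Lab → ℝ` and step numbers `N : Lab → ℕ`)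

* §1 **`measurable_uncurry_leapfrogQPQ`** / **`measurable_uncurry_leapfrogPQP`** — `(δ, z) ↦` one qpq / pqp step is
  jointly measurable (polynomial maps); **`measurable_uncurry_hmcProposal`** / **`…PQP`** — `(l, z) ↦ Ψ^{N_l}_{δ_l}(z)` is
  jointly measurable (label-dependent number of steps: countable union); `measurable_jitterMap_hmcProposal{,PQP}`.
* §2 **`phi4JitterHMCL J λ δ hδ N hN η`** / **`phi4JitterHMCLPQP …`** — the jittered kernels for an ARBITRARY label law;
  `isMarkovKernel_*`; **`phi4JitterHMCL_invariant`** / **`phi4JitterHMCLPQP_invariant`** — `e^{−S}·Leb` is invariant for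
  EVERY probability law `η` on ANY measurable label space; `phi4JitterHMCL_apply` (the `η`-integral of the frozen-step
  kernels).
* §3 THE ENGINE AS RUN: **`phi4LengthJitterHMC J λ nstep η`** (labels `= ℝ` = the drawn length `τ'`, step `τ'/nstep`,
  `nstep` fixed; qpq) and **`phi4LengthJitterHMCPQP`**; **`phi4LengthJitterHMC_invariant`** / **`…PQP_invariant`** — exact
  for EVERY Borel probability law of the length, in particular the code's `uniformJitterLaw τ j` for every `(τ, j)`.

NOT CLAIMED: ergodicity of the φ⁴ HMC (non-compact configuration space — no Doeblin theory for it in the tree); that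
jitter cures the free-field resonances (row 2's `RandomisedHMC.lean` is the statement there); floating point.
-/

noncomputable section

namespace Summit.Ventures.LatticeQCDFlow.Exactness

open MeasureTheory ProbabilityTheory ProbabilityTheory.Kernel Set Function Finset
open Summit.Ventures.LatticeQCDFlow.Scoring
open scoped ENNReal

variable {n : ℕ}

/-! ## §1 Joint measurability in the step size and the phase point -/

section Measurable

variable (J : Fin (n + 1) → Fin (n + 1) → ℝ) (lam : ℝ)

/-- One qpq step is jointly continuous in `(δ, (φ, p))` (it is polynomial). -/
theorem continuous_uncurry_leapfrogQPQ :
    Continuous fun q : ℝ × ((Fin (n + 1) → ℝ) × (Fin (n + 1) → ℝ)) => leapfrogQPQ J lam q.1 q.2 := by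
  unfold leapfrogQPQ lfDrift lfKick latticePhi4Force
  fun_prop

/-- One pqp step is jointly continuous in `(δ, (φ, p))`. -/
theorem continuous_uncurry_leapfrogPQP :
    Continuous fun q : ℝ × ((Fin (n + 1) → ℝ) × (Fin (n + 1) → ℝ)) => leapfrogPQP J lam q.1 q.2 := by
  unfold leapfrogPQP lfDrift lfKick latticePhi4Force
  fun_prop

/-- **One qpq step is jointly measurable in `(δ, z)`.** -/
theorem measurable_uncurry_leapfrogQPQ :
    Measurable fun q : ℝ × ((Fin (n + 1) → ℝ) × (Fin (n + 1) → ℝ)) => leapfrogQPQ J lam q.1 q.2 :=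
  (continuous_uncurry_leapfrogQPQ J lam).measurable

/-- **One pqp step is jointly measurable in `(δ, z)`.** -/
theorem measurable_uncurry_leapfrogPQP :
    Measurable fun q : ℝ × ((Fin (n + 1) → ℝ) × (Fin (n + 1) → ℝ)) => leapfrogPQP J lam q.1 q.2 :=
  (continuous_uncurry_leapfrogPQP J lam).measurable

variable {Lab : Type*} [MeasurableSpace Lab] {δ : Lab → ℝ} {N : Lab → ℕ}

/-- A labelled iteration with a measurable label-dependent number of steps is jointly measurable. -/
theorem measurable_uncurry_iterate {Z : Type*} [MeasurableSpace Z] {f : Lab → Z → Z}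
    (hf : Measurable fun q : Lab × Z => f q.1 q.2) (hN : Measurable N) :
    Measurable fun q : Lab × Z => (f q.1)^[N q.1] q.2 := by
  set W : Lab × Z → Lab × Z := fun q => (q.1, f q.1 q.2) with hW
  have hWm : Measurable W := measurable_fst.prodMk hf
  have hiter : ∀ (k : ℕ) (q : Lab × Z), W^[k] q = (q.1, (f q.1)^[k] q.2) := by
    intro k; induction k with
    | zero => intro q; rfl
    | succ k ih => intro q; rw [Function.iterate_succ_apply', ih, Function.iterate_succ_apply']
  have hF : Measurable fun r : (Lab × Z) × ℕ => (W^[r.2] r.1).2 :=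
    measurable_from_prod_countable_left fun k => measurable_snd.comp (hWm.iterate k)
  have hcomp : (fun q : Lab × Z => (f q.1)^[N q.1] q.2) = fun q => (W^[N q.1] q).2 := by
    funext q; rw [hiter]
  rw [hcomp]
  exact hF.comp (measurable_id.prodMk (hN.comp measurable_fst))

/-- **THE LABELLED qpq PROPOSAL `(l, z) ↦ Ψ^{N_l}_{δ_l}(z)` IS JOINTLY MEASURABLE** (`δ`, `N` measurable). -/
theorem measurable_uncurry_hmcProposal (hδ : Measurable δ) (hN : Measurable N) :
    Measurable fun q : Lab × ((Fin (n + 1) → ℝ) × (Fin (n + 1) → ℝ)) => hmcProposal J lam (δ q.1) (N q.1) q.2 := by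
  have hstep : Measurable fun q : Lab × ((Fin (n + 1) → ℝ) × (Fin (n + 1) → ℝ)) => leapfrogQPQ J lam (δ q.1) q.2 :=
    (measurable_uncurry_leapfrogQPQ J lam).comp ((hδ.comp measurable_fst).prodMk measurable_snd)
  have hit := measurable_uncurry_iterate (f := fun l => leapfrogQPQ J lam (δ l)) hstep hN
  unfold hmcProposal momFlip
  exact (measurable_fst.comp hit).prodMk (measurable_snd.comp hit).neg

/-- **THE LABELLED pqp PROPOSAL IS JOINTLY MEASURABLE.** -/
theorem measurable_uncurry_hmcProposalPQP (hδ : Measurable δ) (hN : Measurable N) :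
    Measurable fun q : Lab × ((Fin (n + 1) → ℝ) × (Fin (n + 1) → ℝ)) => hmcProposalPQP J lam (δ q.1) (N q.1) q.2 := by
  have hstep : Measurable fun q : Lab × ((Fin (n + 1) → ℝ) × (Fin (n + 1) → ℝ)) => leapfrogPQP J lam (δ q.1) q.2 :=
    (measurable_uncurry_leapfrogPQP J lam).comp ((hδ.comp measurable_fst).prodMk measurable_snd)
  have hit := measurable_uncurry_iterate (f := fun l => leapfrogPQP J lam (δ l)) hstep hN
  unfold hmcProposalPQP momFlip
  exact (measurable_fst.comp hit).prodMk (measurable_snd.comp hit).neg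

/-- The jittered qpq proposal on the enlarged phase space is measurable. -/
theorem measurable_jitterMap_hmcProposal (hδ : Measurable δ) (hN : Measurable N) :
    Measurable (jitterMap fun l => hmcProposal J lam (δ l) (N l)) :=
  measurable_jitterMap (measurable_uncurry_hmcProposal J lam hδ hN)

/-- The jittered pqp proposal on the enlarged phase space is measurable. -/
theorem measurable_jitterMap_hmcProposalPQP (hδ : Measurable δ) (hN : Measurable N) :
    Measurable (jitterMap fun l => hmcProposalPQP J lam (δ l) (N l)) :=
  measurable_jitterMap (measurable_uncurry_hmcProposalPQP J lam hδ hN)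

end Measurable

/-! ## §2 The jittered φ⁴ kernels for an arbitrary label law; exact for every law -/

section Jitter

variable {Lab : Type*} [MeasurableSpace Lab]
variable (J : Fin (n + 1) → Fin (n + 1) → ℝ) (lam : ℝ) {δ : Lab → ℝ} (hδ : Measurable δ) {N : Lab → ℕ}
  (hN : Measurable N) (η : Measure Lab)

/-- **THE JITTERED qpq HMC UPDATE FOR LATTICE φ⁴, ANY LABEL LAW** (`phi4_2d.hmc(..., tau_jitter)` with a continuous
jitter): refresh `p ∼ N(0,1)^Λ` and an independent label `l ∼ η`, run `N l` qpq steps of size `δ l`, flip, Metropolis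
test on `S(φ) + ½Σp²`, forget `(p, l)`. -/
def phi4JitterHMCL : Kernel (Fin (n + 1) → ℝ) (Fin (n + 1) → ℝ) :=
  jitterHMC (fun l => hmcProposal J lam (δ l) (N l)) (measurable_jitterMap_hmcProposal J lam hδ hN)
    (latticePhi4Action J lam) (fun p : Fin (n + 1) → ℝ => (∑ x, p x ^ 2) / 2) η (phi4KineticLaw n)

/-- **THE JITTERED pqp HMC UPDATE FOR LATTICE φ⁴, ANY LABEL LAW.** -/
def phi4JitterHMCLPQP : Kernel (Fin (n + 1) → ℝ) (Fin (n + 1) → ℝ) :=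
  jitterHMC (fun l => hmcProposalPQP J lam (δ l) (N l)) (measurable_jitterMap_hmcProposalPQP J lam hδ hN)
    (latticePhi4Action J lam) (fun p : Fin (n + 1) → ℝ => (∑ x, p x ^ 2) / 2) η (phi4KineticLaw n)

/-- The qpq kernel is Markov for every probability law `η`. -/
instance isMarkovKernel_phi4JitterHMCL [IsProbabilityMeasure η] : IsMarkovKernel (phi4JitterHMCL J lam hδ hN η) := by
  unfold phi4JitterHMCL
  exact isMarkovKernel_jitterHMC _ _ η _ (continuous_latticePhi4Action J lam).measurable measurable_phi4Kinetic

/-- The pqp kernel is Markov for every probability law `η`. -/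
instance isMarkovKernel_phi4JitterHMCLPQP [IsProbabilityMeasure η] :
    IsMarkovKernel (phi4JitterHMCLPQP J lam hδ hN η) := by
  unfold phi4JitterHMCLPQP
  exact isMarkovKernel_jitterHMC _ _ η _ (continuous_latticePhi4Action J lam).measurable measurable_phi4Kinetic

/-- **THE JITTERED qpq UPDATE IS EXACT, FOR EVERY LABEL LAW ON ANY MEASURABLE LABEL SPACE**: `e^{−S}·Leb` is
invariant, `S = latticePhi4Action J λ` — every real `J`, `λ`, every measurable `δ`, `N`, every probability law `η`. -/
theorem phi4JitterHMCL_invariant [IsProbabilityMeasure η] :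
    Invariant (phi4JitterHMCL J lam hδ hN η)
      ((volume : Measure (Fin (n + 1) → ℝ)).withDensity fun φ =>
        ENNReal.ofReal (Real.exp (-latticePhi4Action J lam φ))) :=
  jitterHMC_exact (vol := (volume : Measure (Fin (n + 1) → ℝ))) (volP := (volume : Measure (Fin (n + 1) → ℝ)))
    η (continuous_latticePhi4Action J lam).measurable measurable_phi4Kinetic
    (fun l => hmcProposal_involutive J lam (δ l) (N l)) (fun l => measurePreserving_hmcProposal J lam (δ l) (N l))
    phi4KineticWeight_univ_ne_zero phi4KineticWeight_univ_ne_top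

/-- **THE JITTERED pqp UPDATE IS EXACT, FOR EVERY LABEL LAW.** -/
theorem phi4JitterHMCLPQP_invariant [IsProbabilityMeasure η] :
    Invariant (phi4JitterHMCLPQP J lam hδ hN η)
      ((volume : Measure (Fin (n + 1) → ℝ)).withDensity fun φ =>
        ENNReal.ofReal (Real.exp (-latticePhi4Action J lam φ))) :=
  jitterHMC_exact (vol := (volume : Measure (Fin (n + 1) → ℝ))) (volP := (volume : Measure (Fin (n + 1) → ℝ)))
    η (continuous_latticePhi4Action J lam).measurable measurable_phi4Kinetic
    (fun l => hmcProposalPQP_involutive J lam (δ l) (N l))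
    (fun l => measurePreserving_hmcProposalPQP J lam (δ l) (N l))
    phi4KineticWeight_univ_ne_zero phi4KineticWeight_univ_ne_top

/-- **THE `η`-INTEGRAL OF THE FROZEN-LABEL UPDATES**: `K(φ, A) = ∫ K_l(φ, A) η(dl)`, `K_l` the qpq HMC kernel with
step `δ l` and `N l` steps. -/
theorem phi4JitterHMCL_apply [SFinite η] (φ : Fin (n + 1) → ℝ) {A : Set (Fin (n + 1) → ℝ)} (hA : MeasurableSet A) :
    phi4JitterHMCL J lam hδ hN η φ A =
      ∫⁻ l, refreshUpdate (involMH (hmcProposal J lam (δ l) (N l)) (measurable_hmcProposal J lam (δ l) (N l))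
          fun z : (Fin (n + 1) → ℝ) × (Fin (n + 1) → ℝ) => latticePhi4Action J lam z.1 + (∑ x, z.2 x ^ 2) / 2)
        (phi4KineticLaw n) φ A ∂η := by
  haveI : SFinite (phi4KineticLaw n) := by unfold phi4KineticLaw phi4KineticWeight; infer_instance
  rw [phi4JitterHMCL, jitterHMC_apply _ _ η _ (continuous_latticePhi4Action J lam).measurable measurable_phi4Kinetic φ hA]

end Jitter

/-! ## §3 The engine as run: the label is the drawn trajectory length, any Borel law -/

section Engine

variable (J : Fin (n + 1) → Fin (n + 1) → ℝ) (lam : ℝ) (nstep : ℕ) (η : Measure ℝ)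

/-- **`phi4_2d.hmc(..., tau, nstep, variant = 'qpq', tau_jitter)` AS RUN, for a general law `η` of the drawn length
`τ'`**: `nstep` qpq steps of size `τ'/nstep`. -/
def phi4LengthJitterHMC : Kernel (Fin (n + 1) → ℝ) (Fin (n + 1) → ℝ) :=
  phi4JitterHMCL J lam (δ := fun τ' : ℝ => τ' / nstep) (measurable_id.div_const _) (N := fun _ => nstep)
    measurable_const η

/-- **`phi4_2d.hmc(..., variant = 'pqp', tau_jitter)` AS RUN, for a general law of the drawn length.** -/
def phi4LengthJitterHMCPQP : Kernel (Fin (n + 1) → ℝ) (Fin (n + 1) → ℝ) :=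
  phi4JitterHMCLPQP J lam (δ := fun τ' : ℝ => τ' / nstep) (measurable_id.div_const _) (N := fun _ => nstep)
    measurable_const η

/-- **EXACT FOR EVERY LAW OF THE TRAJECTORY LENGTH** (qpq): atomless (the idealised uniform `tau_jitter` law
`uniformJitterLaw τ j`), atomic (the code's 53-bit uniform) or any Borel probability law on `ℝ`. -/
theorem phi4LengthJitterHMC_invariant [IsProbabilityMeasure η] :
    Invariant (phi4LengthJitterHMC J lam nstep η)
      ((volume : Measure (Fin (n + 1) → ℝ)).withDensity fun φ =>
        ENNReal.ofReal (Real.exp (-latticePhi4Action J lam φ))) :=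
  phi4JitterHMCL_invariant J lam _ _ η

/-- **EXACT FOR EVERY LAW OF THE TRAJECTORY LENGTH** (pqp). -/
theorem phi4LengthJitterHMCPQP_invariant [IsProbabilityMeasure η] :
    Invariant (phi4LengthJitterHMCPQP J lam nstep η)
      ((volume : Measure (Fin (n + 1) → ℝ)).withDensity fun φ =>
        ENNReal.ofReal (Real.exp (-latticePhi4Action J lam φ))) :=
  phi4JitterHMCLPQP_invariant J lam _ _ η

end Engine

end Summit.Ventures.LatticeQCDFlow.Exactness
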